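import Summits.QuantumFields.BalabanUV.Beta.GAN24.DerivativeRateTransferLoewnerKKT

/-!
# `BalabanUV.Beta.GAN24.DerivativeRateTransferJensenChain` — binder row G-an2-4 ∕ (CONV-C), route R6 «VALUES, NOT DERIVATIVES», PART 21:
# ONE-CHAIN LETTERS FOR THE COVARIANT JENSEN INEQUALITY — orthogonal colour transports preserve the pairing, the TELESCOPING identity along a
# bond chain `T_ℓ·u(x_ℓ) − u(x_0) = Σ_{i<ℓ} T_i·(R_i u(x_{i+1}) − u(x_i))`, its Cauchy–Schwarz bound, the holonomy split (Peter–Paul), and the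
# weighted Jensen inequality for transported block means (unit b2b-balaban-gan24-p3, gen 37; v1)

NOT IN PRINT; OUR PROOF (for the ROUTE; [folklore] finite-dimensional linear algebra over `ℝ`: `Finset.sum_range_sub`, `sq_sum_le_card_mul_sum_sq`,
`Finset.sum_sq_le_sum_mul_sum_of_sq_le_mul`).  HONEST FRAMING (cell contract, verbatim): «discharging `BetaPertH` makes Bałaban's UV stability
UNCONDITIONAL — a real constructive-QFT result; it is NOT the continuum limit and NOT the Clay problem.»  HONEST DEPENDENCY (verbatim): «continuum YM on
T⁴ ⇐ BetaPertH ∧ nine spine estimates (0/9 proved); BetaPertH ⇐ (D1) ∧ (D4) ∧ CAP+tail; G-an2-4 gates asym, D1 and NE2/3/4.»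

WHY THIS FILE.  Route R6's (STAB) with background is «NOT IN PRINT as a form inequality — to be PROVED (Jensen for transported block averages +
curvature slack)» (ROUTES-GAN24 v36 §2 R6).  The proof is one computation per (coarse bond, fine site): the coarse covariant difference of a
transported block mean is the block mean of TRANSPORTED CHAINS of fine covariant differences plus a HOLONOMY defect.  This PART supplies the one-chain
letters (colour vectors `o → ℝ`, transporters `Matrix o o ℝ` with `RᵀR = 1`, pairing `⬝ᵥ`); PART 22 (`DerivativeRateTransferJensen`) sums them over
bonds and blocks into (STAB-ε,δ) for PART 20 (`DerivativeRateTransferLoewnerGram`).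

WHAT THIS FILE PROVES (0 sorry, 0 `def`, nothing cited):
* §1 orthogonal letters: `dotProduct_mulVec_mulVec_of_orthogonal` (`RᵀR = 1 ⟹ ⟨Rv, Rw⟩ = ⟨v, w⟩`), `self_of_orthogonal`, `orthogonal_mul`,
  `mul_transpose_of_orthogonal` (`RRᵀ = 1`), `transpose_orthogonal`.
* §2 scalar tools: `dotProduct_self_nonneg'`, **`dotProduct_self_add_le`** (Peter–Paul: `|a + b|² ≤ (1+t)|a|² + (1+t⁻¹)|b|²`, `t > 0`),
  **`dotProduct_self_sum_le_card_mul`** (`|Σ_{i∈s} v_i|² ≤ #s · Σ_{i∈s} |v_i|²`), `dotProduct_self_wsum_le'` ∕ **`dotProduct_self_wsum_le`** (weighted Jensen for transported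
  means: `q ≥ 0`, `Σ q ≤ 1`, `W_xᵀW_x = 1` ⟹ `|Σ_x q_x W_x v_x|² ≤ Σ_x q_x |v_x|²`), `dotProduct_self_defect_le` (`|(V − 1)w|² ≤ κ²|w|²` read).
* §3 chains: partial transports `T 0 = 1`, `T (i+1) = T i · R i` are orthogonal (`orthogonal_partialTransport`); **`chain_telescope`**
  (`T_ℓ u_ℓ − u_0 = Σ_{i<ℓ} T_i (R_i u_{i+1} − u_i)`); **`dotProduct_self_chain_le`** (`|T_ℓ u_ℓ − u_0|² ≤ ℓ · Σ_{i<ℓ} |R_i u_{i+1} − u_i|²`);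
  **`dotProduct_self_holonomy_chain_le`** (`|V T_ℓ u_ℓ − u_0|² ≤ (1+t)·ℓ·Σ_{i<ℓ}|R_i u_{i+1} − u_i|² + (1+t⁻¹)·κ²·|u_ℓ|²` when `|(V−1)w|² ≤ κ²|w|²`).
WHAT IT DOES NOT DO: anything lattice-specific (PART 22); assert that Bałaban's transporters ∕ contours instantiate the letters (S2(ii)).  SUPPLIER work on
route R6 (rank 2, REDUCTION, no seat; X-A8 ∕ X-C1 not minted); no consumer of record; NEVER «G-an2-4 closed»; NOT (CONV-C), NOT D1, NOT `BetaPertH`, NOT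
continuum, NOT Clay.  Records: `HOME/b2b-balaban-gan24-p3/WOODBURY-FIBRE.md` v13.7, `HOME/beta/ROUTES-GAN24.md` v36 §2 R6.
-/

noncomputable section

open Matrix Finset

namespace Summit.QuantumFields.BalabanUV.Beta.GAN24.DerivativeRateTransferJensenChain

open Summit.QuantumFields.BalabanUV.Beta.GAN24.DerivativeRateTransferLoewnerKKT (mulVec_dotProduct_eq)

variable {o : Type*} [Fintype o] [DecidableEq o]

/-! ## §1 Orthogonal colour transporters -/

section Orthogonal

/-- **`RᵀR = 1 ⟹ ⟨Rv, Rw⟩ = ⟨v, w⟩`** — orthogonal transport preserves the pairing. [folklore] -/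
theorem dotProduct_mulVec_mulVec_of_orthogonal {R : Matrix o o ℝ} (hR : Rᵀ * R = 1) (v w : o → ℝ) :
    (R *ᵥ v) ⬝ᵥ (R *ᵥ w) = v ⬝ᵥ w := by
  rw [mulVec_dotProduct_eq, mulVec_mulVec, hR, one_mulVec]

/-- `RᵀR = 1 ⟹ |Rv|² = |v|²`. [folklore] -/
theorem self_of_orthogonal {R : Matrix o o ℝ} (hR : Rᵀ * R = 1) (v : o → ℝ) : (R *ᵥ v) ⬝ᵥ (R *ᵥ v) = v ⬝ᵥ v :=
  dotProduct_mulVec_mulVec_of_orthogonal hR v v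

omit [DecidableEq o] in
/-- products of orthogonal transporters are orthogonal. [folklore] -/
theorem orthogonal_mul [DecidableEq o] {R S : Matrix o o ℝ} (hR : Rᵀ * R = 1) (hS : Sᵀ * S = 1) : (R * S)ᵀ * (R * S) = 1 := by
  rw [transpose_mul, Matrix.mul_assoc, ← Matrix.mul_assoc Rᵀ, hR, Matrix.one_mul, hS]

/-- `RᵀR = 1 ⟹ RRᵀ = 1` (square matrices). [folklore] -/
theorem mul_transpose_of_orthogonal {R : Matrix o o ℝ} (hR : Rᵀ * R = 1) : R * Rᵀ = 1 :=
  mul_eq_one_comm.mp hR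

/-- `RᵀR = 1 ⟹ (Rᵀ)ᵀRᵀ = 1` — the inverse transporter is orthogonal. [folklore] -/
theorem transpose_orthogonal {R : Matrix o o ℝ} (hR : Rᵀ * R = 1) : (Rᵀ)ᵀ * Rᵀ = 1 := by
  rw [transpose_transpose]; exact mul_transpose_of_orthogonal hR

end Orthogonal

/-! ## §2 Scalar tools: Peter–Paul, the chain Cauchy–Schwarz bound, weighted Jensen -/

section Scalar

omit [DecidableEq o] in
/-- `0 ≤ |v|²`. [folklore] -/
theorem dotProduct_self_nonneg' (v : o → ℝ) : 0 ≤ v ⬝ᵥ v :=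
  Finset.sum_nonneg fun _ _ => mul_self_nonneg _

omit [DecidableEq o] in
/-- **PETER–PAUL**: `|a + b|² ≤ (1 + t)|a|² + (1 + t⁻¹)|b|²` for `t > 0`. [folklore] -/
theorem dotProduct_self_add_le (a b : o → ℝ) {t : ℝ} (ht : 0 < t) :
    (a + b) ⬝ᵥ (a + b) ≤ (1 + t) * (a ⬝ᵥ a) + (1 + t⁻¹) * (b ⬝ᵥ b) := by
  simp only [dotProduct, Pi.add_apply, Finset.mul_sum, ← Finset.sum_add_distrib]
  refine Finset.sum_le_sum fun i _ => ?_
  have ht1 : t * (1 + t⁻¹) = t + 1 := by field_simp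
  have key : t * ((a i + b i) * (a i + b i)) ≤ t * ((1 + t) * (a i * a i) + (1 + t⁻¹) * (b i * b i)) := by
    have : t * ((1 + t) * (a i * a i) + (1 + t⁻¹) * (b i * b i)) = t * (1 + t) * (a i * a i) + (t + 1) * (b i * b i) := by
      rw [← ht1]; ring
    rw [this]; nlinarith [sq_nonneg (t * a i - b i)]
  exact le_of_mul_le_mul_left key ht

omit [DecidableEq o] in
/-- **THE CHAIN CAUCHY–SCHWARZ BOUND**: `|Σ_{i∈s} v_i|² ≤ #s · Σ_{i∈s} |v_i|²`. [folklore] -/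
theorem dotProduct_self_sum_le_card_mul {ι : Type*} (s : Finset ι) (v : ι → o → ℝ) :
    (∑ i ∈ s, v i) ⬝ᵥ (∑ i ∈ s, v i) ≤ s.card * ∑ i ∈ s, (v i ⬝ᵥ v i) := by
  simp only [dotProduct, Finset.sum_apply]
  rw [Finset.sum_comm (s := s), Finset.mul_sum]
  refine Finset.sum_le_sum fun a _ => ?_
  have h := sq_sum_le_card_mul_sum_sq (s := s) (f := fun i => v i a)
  simp only [sq] at h
  exact h

omit [DecidableEq o] in
/-- **WEIGHTED JENSEN** (no transport): weights `q_x ≥ 0` with `Σ_x q_x ≤ 1` ⟹ `|Σ_x q_x·w_x|² ≤ Σ_x q_x·|w_x|²`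
(coordinatewise Cauchy–Schwarz with `r = q w`, `f = q`, `g = q w²`, then `Σ q ≤ 1`). [folklore] -/
theorem dotProduct_self_wsum_le' {ν : Type*} (s : Finset ν) {q : ν → ℝ} (hq : ∀ x ∈ s, 0 ≤ q x) (hq1 : ∑ x ∈ s, q x ≤ 1)
    (w : ν → o → ℝ) :
    (∑ x ∈ s, q x • w x) ⬝ᵥ (∑ x ∈ s, q x • w x) ≤ ∑ x ∈ s, q x * (w x ⬝ᵥ w x) := by
  have lhs : (∑ x ∈ s, q x • w x) ⬝ᵥ (∑ x ∈ s, q x • w x) = ∑ a, (∑ x ∈ s, q x * w x a) * (∑ x ∈ s, q x * w x a) := by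
    simp only [dotProduct, Finset.sum_apply, Pi.smul_apply, smul_eq_mul]
  have rhs : ∑ x ∈ s, q x * (w x ⬝ᵥ w x) = ∑ a, ∑ x ∈ s, q x * (w x a * w x a) := by
    simp only [dotProduct, Finset.mul_sum]; exact Finset.sum_comm
  rw [lhs, rhs]
  refine Finset.sum_le_sum fun a _ => ?_
  -- coordinate `a`: `(Σ_x q_x w_x(a))² ≤ (Σ_x q_x)·(Σ_x q_x w_x(a)²) ≤ Σ_x q_x w_x(a)²`
  have hcs := Finset.sum_sq_le_sum_mul_sum_of_sq_le_mul s (r := fun x => q x * w x a) (f := q)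
    (g := fun x => q x * (w x a * w x a)) hq (fun x hx => mul_nonneg (hq x hx) (mul_self_nonneg _))
    (fun x _ => by ring_nf; nlinarith [sq_nonneg (q x * w x a)])
  have hg0 : 0 ≤ ∑ x ∈ s, q x * (w x a * w x a) := Finset.sum_nonneg fun x hx => mul_nonneg (hq x hx) (mul_self_nonneg _)
  rw [sq] at hcs
  calc (∑ x ∈ s, q x * w x a) * ∑ x ∈ s, q x * w x a
      ≤ (∑ x ∈ s, q x) * ∑ x ∈ s, q x * (w x a * w x a) := hcs
    _ ≤ 1 * ∑ x ∈ s, q x * (w x a * w x a) := mul_le_mul_of_nonneg_right hq1 hg0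
    _ = ∑ x ∈ s, q x * (w x a * w x a) := one_mul _

/-- **WEIGHTED JENSEN FOR TRANSPORTED MEANS**: weights `q_x ≥ 0` with `Σ_x q_x ≤ 1`, orthogonal transporters `W_xᵀW_x = 1` ⟹
`|Σ_x q_x·W_x v_x|² ≤ Σ_x q_x·|v_x|²` (`|W_x v_x| = |v_x|`). [folklore] -/
theorem dotProduct_self_wsum_le {ν : Type*} (s : Finset ν) {q : ν → ℝ} (hq : ∀ x ∈ s, 0 ≤ q x) (hq1 : ∑ x ∈ s, q x ≤ 1)
    {W : ν → Matrix o o ℝ} (hW : ∀ x ∈ s, (W x)ᵀ * W x = 1) (v : ν → o → ℝ) :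
    (∑ x ∈ s, q x • (W x *ᵥ v x)) ⬝ᵥ (∑ x ∈ s, q x • (W x *ᵥ v x)) ≤ ∑ x ∈ s, q x * (v x ⬝ᵥ v x) :=
  calc (∑ x ∈ s, q x • (W x *ᵥ v x)) ⬝ᵥ (∑ x ∈ s, q x • (W x *ᵥ v x))
      ≤ ∑ x ∈ s, q x * ((W x *ᵥ v x) ⬝ᵥ (W x *ᵥ v x)) := dotProduct_self_wsum_le' s hq hq1 fun x => W x *ᵥ v x
    _ = ∑ x ∈ s, q x * (v x ⬝ᵥ v x) := Finset.sum_congr rfl fun x hx => by rw [self_of_orthogonal (hW x hx)]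

/-- the holonomy defect read: `|(V − 1)w|² ≤ κ²·|w|²` is the hypothesis shape; with `RᵀR = 1` it transports: `|(V − 1)(Rw)|² ≤ κ²|w|²`. [folklore] -/
theorem dotProduct_self_defect_le {V R : Matrix o o ℝ} {κ : ℝ}
    (hV : ∀ w : o → ℝ, ((V - 1) *ᵥ w) ⬝ᵥ ((V - 1) *ᵥ w) ≤ κ ^ 2 * (w ⬝ᵥ w)) (hR : Rᵀ * R = 1) (w : o → ℝ) :
    ((V - 1) *ᵥ (R *ᵥ w)) ⬝ᵥ ((V - 1) *ᵥ (R *ᵥ w)) ≤ κ ^ 2 * (w ⬝ᵥ w) := by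
  rw [← self_of_orthogonal hR w]; exact hV _

end Scalar

/-! ## §3 Chains: partial transports, telescoping, the chain bound, the holonomy split -/

section Chain

variable {R : ℕ → Matrix o o ℝ} {T : ℕ → Matrix o o ℝ} {ℓ : ℕ}

/-- partial transports along a chain of orthogonal bond transporters are orthogonal: `T 0 = 1`, `T (i+1) = T i · R i`, `R_iᵀR_i = 1` (`i < ℓ`)
⟹ `T_iᵀT_i = 1` for `i ≤ ℓ`. [folklore] -/
theorem orthogonal_partialTransport (hR : ∀ i, i < ℓ → (R i)ᵀ * R i = 1) (hT0 : T 0 = 1) (hT : ∀ i, i < ℓ → T (i + 1) = T i * R i) :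
    ∀ i, i ≤ ℓ → (T i)ᵀ * T i = 1 := by
  intro i
  induction i with
  | zero => intro _; rw [hT0, transpose_one, Matrix.one_mul]
  | succ i ih =>
    intro hi
    rw [hT i (by omega)]
    exact orthogonal_mul (ih (by omega)) (hR i (by omega))

/-- **THE TELESCOPING IDENTITY ALONG A CHAIN**: `T 0 = 1`, `T (i+1) = T i · R i` ⟹
`T_ℓ u_ℓ − u_0 = Σ_{i<ℓ} T_i·(R_i u_{i+1} − u_i)` (each summand is `T_{i+1}u_{i+1} − T_i u_i`). [folklore] -/
theorem chain_telescope (hT0 : T 0 = 1) (hT : ∀ i, i < ℓ → T (i + 1) = T i * R i) (u : ℕ → o → ℝ) :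
    T ℓ *ᵥ u ℓ - u 0 = ∑ i ∈ range ℓ, T i *ᵥ (R i *ᵥ u (i + 1) - u i) := by
  have h : ∀ i ∈ range ℓ, T i *ᵥ (R i *ᵥ u (i + 1) - u i) = T (i + 1) *ᵥ u (i + 1) - T i *ᵥ u i := fun i hi => by
    rw [mulVec_sub, mulVec_mulVec, ← hT i (mem_range.mp hi)]
  rw [sum_congr rfl h, Finset.sum_range_sub (fun i => T i *ᵥ u i), hT0, one_mulVec]

/-- **THE CHAIN BOUND**: orthogonal bond transporters ⟹ `|T_ℓ u_ℓ − u_0|² ≤ ℓ · Σ_{i<ℓ} |R_i u_{i+1} − u_i|²`. [our proof] -/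
theorem dotProduct_self_chain_le (hR : ∀ i, i < ℓ → (R i)ᵀ * R i = 1) (hT0 : T 0 = 1) (hT : ∀ i, i < ℓ → T (i + 1) = T i * R i)
    (u : ℕ → o → ℝ) :
    (T ℓ *ᵥ u ℓ - u 0) ⬝ᵥ (T ℓ *ᵥ u ℓ - u 0) ≤ ℓ * ∑ i ∈ range ℓ, (R i *ᵥ u (i + 1) - u i) ⬝ᵥ (R i *ᵥ u (i + 1) - u i) := by
  rw [chain_telescope hT0 hT u]
  refine (dotProduct_self_sum_le_card_mul _ _).trans ?_
  rw [card_range]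
  refine mul_le_mul_of_nonneg_left (le_of_eq (sum_congr rfl fun i hi => ?_)) (Nat.cast_nonneg _)
  exact self_of_orthogonal (orthogonal_partialTransport hR hT0 hT i (mem_range.mp hi).le) _

/-- **THE HOLONOMY SPLIT**: with a loop holonomy `V`, `|(V − 1)w|² ≤ κ²|w|²` for all `w`, orthogonal bond transporters and `t > 0`:
`|V·T_ℓ u_ℓ − u_0|² ≤ (1+t)·ℓ·Σ_{i<ℓ}|R_i u_{i+1} − u_i|² + (1+t⁻¹)·κ²·|u_ℓ|²`
(`V T_ℓ u_ℓ − u_0 = (T_ℓ u_ℓ − u_0) + (V − 1)T_ℓ u_ℓ`, Peter–Paul, the chain bound, `|T_ℓ u_ℓ| = |u_ℓ|`). [our proof] -/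
theorem dotProduct_self_holonomy_chain_le (hR : ∀ i, i < ℓ → (R i)ᵀ * R i = 1) (hT0 : T 0 = 1)
    (hT : ∀ i, i < ℓ → T (i + 1) = T i * R i) {V : Matrix o o ℝ} {κ t : ℝ}
    (hV : ∀ w : o → ℝ, ((V - 1) *ᵥ w) ⬝ᵥ ((V - 1) *ᵥ w) ≤ κ ^ 2 * (w ⬝ᵥ w)) (ht : 0 < t) (u : ℕ → o → ℝ) :
    (V *ᵥ (T ℓ *ᵥ u ℓ) - u 0) ⬝ᵥ (V *ᵥ (T ℓ *ᵥ u ℓ) - u 0) ≤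
      (1 + t) * (ℓ * ∑ i ∈ range ℓ, (R i *ᵥ u (i + 1) - u i) ⬝ᵥ (R i *ᵥ u (i + 1) - u i)) +
        (1 + t⁻¹) * (κ ^ 2 * (u ℓ ⬝ᵥ u ℓ)) := by
  have e : V *ᵥ (T ℓ *ᵥ u ℓ) - u 0 = (T ℓ *ᵥ u ℓ - u 0) + (V - 1) *ᵥ (T ℓ *ᵥ u ℓ) := by
    rw [sub_mulVec, one_mulVec]; abel
  rw [e]
  refine (dotProduct_self_add_le _ _ ht).trans (add_le_add ?_ ?_)
  · exact mul_le_mul_of_nonneg_left (dotProduct_self_chain_le hR hT0 hT u) (by linarith)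
  · refine mul_le_mul_of_nonneg_left ?_ (by positivity)
    exact dotProduct_self_defect_le hV (orthogonal_partialTransport hR hT0 hT ℓ le_rfl) (u ℓ)

end Chain

end Summit.QuantumFields.BalabanUV.Beta.GAN24.DerivativeRateTransferJensenChain

end
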